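import Summits.HubbardSuperconductivity.HubbardSuperconductivity.Theorems.AnisotropyChordTransferFibre3FinXDCheck

/-!
# Route `AnisotropyChord` / H0 rotor rung: FIN per-`L` row-D (KT-2a″) SUB-CELL facts, `L = 9` (36–41)

Row-D facts `xdCellAny0 9 (49/50) la lb aD = true` on quarter sub-cells of the combined cells whose side condition needs `aD ≈ .04` (mechhunt STATUS p3 g7 REPORT 3).
Prover seat `hubbard-h0-rotor-p3` g7; helper for piece A = stmt-HubbardSuperconductivity-23918 of rung 19089 (`--supports`, helper class).
WHAT THIS IS NOT: nothing here proves superconductivity in the Hubbard model (rotor TARGET as worded stays FALSE, g15 verdict); kernel facts /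
assembly for ONE conditional reduction at one `L`.  No sorry.
-/

set_option linter.dupNamespace false
set_option autoImplicit false

namespace Summit.HubbardSuperconductivity.HubbardSuperconductivity.Theorems.AnisotropyChord.Transfer.Fibre3

namespace FinXD

/-- row-D sub-cell `[13432568094272625, 13516521644861828]` of `L = 9`. [folklore] -/
theorem xd9s_120_0 : xdCellAny0 9 (49/50 : ℚ) 13432568094272625 13516521644861828 (1/25 : ℚ) = true := by decide +kernel

/-- row-D sub-cell `[13516521644861828, 13600475195451032]` of `L = 9`. [folklore] -/
theorem xd9s_120_1 : xdCellAny0 9 (49/50 : ℚ) 13516521644861828 13600475195451032 (1/25 : ℚ) = true := by decide +kernel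

/-- row-D sub-cell `[13600475195451032, 13684428746040235]` of `L = 9`. [folklore] -/
theorem xd9s_120_2 : xdCellAny0 9 (49/50 : ℚ) 13600475195451032 13684428746040235 (1/25 : ℚ) = true := by decide +kernel

/-- row-D sub-cell `[13684428746040235, 13768382296629439]` of `L = 9`. [folklore] -/
theorem xd9s_120_3 : xdCellAny0 9 (49/50 : ℚ) 13684428746040235 13768382296629439 (1/25 : ℚ) = true := by decide +kernel

/-- row-D sub-cell `[13768382296629439, 13854434685983373]` of `L = 9`. [folklore] -/
theorem xd9s_121_0 : xdCellAny0 9 (49/50 : ℚ) 13768382296629439 13854434685983373 (1/25 : ℚ) = true := by decide +kernel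

/-- row-D sub-cell `[13854434685983373, 13940487075337307]` of `L = 9`. [folklore] -/
theorem xd9s_121_1 : xdCellAny0 9 (49/50 : ℚ) 13854434685983373 13940487075337307 (1/25 : ℚ) = true := by decide +kernel

end FinXD

end Summit.HubbardSuperconductivity.HubbardSuperconductivity.Theorems.AnisotropyChord.Transfer.Fibre3
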